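import Summits.FinalStateConjecture.FinalStateConjecture.Theses.PhotonSphereChannels
import Summits.FinalStateConjecture.FinalStateConjecture.Theorems.PhotonSphereChannelsTameHullDefs
import Summits.FinalStateConjecture.FinalStateConjecture.Theorems.PhotonSphereChannelsDarkFutureDefs
import Summits.FinalStateConjecture.FinalStateConjecture.Theorems.PhotonSphereChannelsKerrDevDefs
import Summits.FinalStateConjecture.FinalStateConjecture.Cruxes.ChannelsResolveTameDevelopmentsR.Lines.tame_lasalle_dock
import Literature.Geometry.Lorentzian.Stationary
import Literature.Geometry.Lorentzian.StationaryVacuumRigidity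
import HarnessLib.Audit

/-!
# Census S9 — typed companions of `STRATEGY-CENSUS-s9.md` (crux stmt-FinalStateConjecture-17430,
`PhotonSphereChannels.ChannelsResolveTameDevelopmentsR`, "K2R")

Second, INDEPENDENT strategy census (planner-cstrat-stmt-FinalStateConjecture-17430-s9-0, 2026-08-17).
Nothing here is a stub or a line; every theorem is sorry-free logic over existing declarations and serves
only to make the census headings CHECKABLE:

* §1 `SEKHyp` / `SEKConcl` / `sek_iff` — the registered dock `TameLaSalleDock.SilentEternalIsKerr` (SEK)
  repackaged as `∀ …, SEKHyp → SEKConcl` (faithfulness certified by `sek_iff`).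
* §2 (heading Decomposition / Transfer) the DOCK RE-CUT: `FarGuard` (the far chart's `∂₀` is future-directed
  causal — exactly `IsTameEnd.far_future`, which kills the refuter's Schwarzschild-interior witness against SEK
  as typed), `SilentIsStationary` (B′_glob: silent eternal end ⇒ a stationary Killing field, timelike on the
  far cylinder — the transferable "non-radiative ⇒ stationary" half) and `StationaryIsKerrOrFlat` (U_glob:
  smooth no-hair / no-geon for GLOBALLY stationary ends — the non-transferable half), with the modus-ponens
  assembly `sekGuarded_of_recut` and the comparison `sekGuarded_of_sek` (guarded SEK ≤ registered SEK).
* §3 (heading Weaker intermediate) the RE-INDEXING SCHEMA: for every pointwise extra hypothesis `H` on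
  developments, `ChannelsResolveWith H → TameCensorshipWith H → FinalStateConjecture` (`finalState_of_reindexed`,
  the `closes` proof with one more conjunct), with `ChannelsResolveWith` antitone and `TameCensorshipWith`
  requiring more as `H` strengthens (`channelsResolveWith_mono`, the price is paid in K3), and the instance
  `H := NoExoticStationaryRemnant` (H7 of the census).
-/

noncomputable section

open Set Filter Function TopologicalSpace Manifold Bundle
open scoped Topology Manifold ContDiff ENNReal NNReal BigOperators

namespace Summit.FinalStateConjecture.FinalStateConjecture.Cruxes.ChannelsResolveTameDevelopmentsR.CensusS9

open Literature.Geometry.Lorentzian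
open Summit.FinalStateConjecture.FinalStateConjecture.Theorems.TameHull
open Summit.FinalStateConjecture.FinalStateConjecture.Theses.PhotonSphereChannels
open Summit.FinalStateConjecture.FinalStateConjecture.Cruxes.ChannelsResolveTameDevelopmentsR.TameLaSalleDock

/-! ### §1 The registered dock SEK, repackaged -/

/-- The far deviation `h = Φ^* g − g_{M,0}` of SEK's far chart, extended by zero. [folklore] -/
def farDev {R : ℝ} (M : ℝ) (𝓢 : Spacetime.{0} 4) (Φ : Kerr.region (0 : ℝ) R → 𝓢.carrier) :
    E4 → E4 →L[ℝ] E4 →L[ℝ] ℝ :=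
  𝓢.deviationExtend (⟨Kerr.region 0 R, Kerr.bilin M 0, fun x ↦ x 0, Kerr.radius 0⟩ : ModelBackground) Φ

/-- `∂₀` of the far deviation. [folklore] -/
def farDevDot {R : ℝ} (M : ℝ) (𝓢 : Spacetime.{0} 4) (Φ : Kerr.region (0 : ℝ) R → 𝓢.carrier) :
    E4 → E4 →L[ℝ] E4 →L[ℝ] ℝ :=
  fun y ↦ fderiv ℝ (farDev M 𝓢 Φ) y (E4.basisVector 0)

set_option synthInstance.maxHeartbeats 120000 in
/-- The hypothesis block of SEK on `(M, R, C, 𝓢, Φ)`, verbatim up to naming the two `let`s (`farDev`,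
`farDevDot`): reference mass and radius, vacuum, global hyperbolicity, an injective `C^∞` local-diffeomorphic
ETERNAL far chart with all-orders `r`-weighted bounds, two-sided non-radiating at every order,
black-hole-or-complete. [cite: AlexakisSchlue2018, Thm. 1.1] -/
def SEKHyp (M R : ℝ) (C : ℕ → ℝ) (𝓢 : Spacetime.{0} 4) [𝓢.metric.toPseudoRiemannianMetric.HasLeviCivita]
    (Φ : Kerr.region (0 : ℝ) R → 𝓢.carrier) : Prop :=
  0 ≤ M ∧ max (2 * M) 0 < R ∧ 𝓢.metric.toPseudoRiemannianMetric.IsRicciFlat ∧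
  𝓢.metric.IsGloballyHyperbolic 𝓢.timeOrientation ∧
  IsLocalDiffeomorph 𝓘(ℝ, E4) (𝓡 4) (⊤ : ℕ∞) Φ ∧ Function.Injective Φ ∧
  ((∀ (m : ℕ) (x : Kerr.region (0 : ℝ) R),
      ‖iteratedFDeriv ℝ m (farDev M 𝓢 Φ) x.1‖ * Kerr.radius 0 x.1 ≤ C m) ∧
   (∀ (m : ℕ), ∀ δ > (0 : ℝ), ∃ R' : ℝ, ∀ x : Kerr.region (0 : ℝ) R,
      R' < Kerr.radius 0 x.1 → ‖iteratedFDeriv ℝ m (farDevDot M 𝓢 Φ) x.1‖ * Kerr.radius 0 x.1 ≤ δ)) ∧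
  ((𝓢.blackHoleRegionOfEnd (Set.range Φ)).Nonempty ∨
    (𝓢.metric.IsTimelikeGeodesicallyComplete ∧ 𝓢.metric.IsNullGeodesicallyComplete))

/-- The conclusion of SEK on `(𝓢, Φ)`, verbatim: the d.o.c. of the far end is a Kerr exterior `0 < M'`,
`|a| ≤ M'`, or `𝓢` is Minkowski. [cite: ChruscielCosta2008, Thm 1.1] -/
def SEKConcl {R : ℝ} [Kerr.Facts] (𝓢 : Spacetime.{0} 4) (Φ : Kerr.region (0 : ℝ) R → 𝓢.carrier) : Prop :=
  (∃ (M' a : ℝ), 0 < M' ∧ |a| ≤ M' ∧ ∃ Ψ : Kerr.exterior M' a → 𝓢.carrier, Function.Injective Ψ ∧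
      Set.range Ψ = 𝓢.docOfEnd (Set.range Φ) ∧
      PseudoRiemannianMetric.IsLocalIsometry
        (Kerr.smoothMetric M' a (Kerr.rPlus M' a)).toPseudoRiemannianMetric 𝓢.metric.toPseudoRiemannianMetric Ψ) ∨
  (∃ Ψ : Diffeomorph (𝓡 4) 𝓘(ℝ, E4) 𝓢.carrier E4 (⊤ : ℕ∞),
      PseudoRiemannianMetric.IsIsometry 𝓢.metric.toPseudoRiemannianMetric
        (Minkowski.metric.ofLE le_top : LorentzianMetric 𝓘(ℝ, E4) (⊤ : ℕ∞) E4).toPseudoRiemannianMetric Ψ)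

/-- SEK in packaged form. [cite: AlexakisIonescuKlainerman2009, Thm 1.1] -/
def SEKPackaged : Prop :=
  ∀ (M R : ℝ) (C : ℕ → ℝ) (𝓢 : Spacetime.{0} 4) [𝓢.metric.toPseudoRiemannianMetric.HasLeviCivita] [Kerr.Facts]
    (Φ : Kerr.region (0 : ℝ) R → 𝓢.carrier), SEKHyp M R C 𝓢 Φ → SEKConcl 𝓢 Φ

/-- **Faithfulness of the packaging**: the registered dock `SilentEternalIsKerr` is, binder for binder, the
packaged statement. [folklore] -/
theorem sek_iff : SilentEternalIsKerr ↔ SEKPackaged := by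
  constructor
  · intro h M R C 𝓢 _ _ Φ hyp
    obtain ⟨hM, hR, hric, hgh, hld, hinj, ⟨hb, hnr⟩, hbh⟩ := hyp
    exact h M R C hM hR 𝓢 hric hgh Φ hld hinj hb hnr hbh
  · intro h M R C hM hR 𝓢 _ _ hric hgh Φ hld hinj
    dsimp only
    intro hb hnr hbh
    exact h M R C 𝓢 Φ ⟨hM, hR, hric, hgh, hld, hinj, ⟨hb, hnr⟩, hbh⟩

/-! ### §2 The dock re-cut (Decomposition / Transfer): SEK_guarded ⇐ B′_glob ∧ U_glob -/

/-- **Far guard**: the far chart's coordinate field `∂₀` is future-directed (causal) everywhere on the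
cylinder — verbatim the clause `IsTameEnd.far_future` every hull element carries. It excludes far charts
dipping into a black-hole interior (the refuter's Schwarzschild witness against SEK as typed: there
`∂_{t*}` is spacelike). [folklore] -/
def FarGuard {R : ℝ} (𝓢 : Spacetime.{0} 4) (Φ : Kerr.region (0 : ℝ) R → 𝓢.carrier) : Prop :=
  ∀ x : Kerr.region (0 : ℝ) R, 𝓢.timeOrientation.IsFutureDirected (mfderiv 𝓘(ℝ, E4) (𝓡 4) Φ x (E4.basisVector 0))

/-- **Stationary near the end**: `𝓢` carries a stationary Killing field with respect to the far cylinder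
(a complete Killing field, timelike future-directed on `range Φ`; Chruściel–Costa's intrinsic form).
[cite: ChruscielCosta2008, Thm 1.1] -/
def StationaryNearEnd {R : ℝ} (𝓢 : Spacetime.{0} 4) [𝓢.metric.toPseudoRiemannianMetric.HasLeviCivita]
    (Φ : Kerr.region (0 : ℝ) R → 𝓢.carrier) : Prop :=
  ∃ X₀ : Π x : 𝓢.carrier, TangentSpace (𝓡 4) x, 𝓢.IsStationaryKilling X₀ (Set.range Φ)

/-- **B′_glob — silent eternal vacua are STATIONARY** (the transferable half of the dock: the nonlinear
analogue of "non-radiative ⇒ soliton-like", far zone by Alexakis–Schlue-type unique continuation from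
infinity, interior by a GLOBAL argument): under SEK's hypotheses and the far guard, `𝓢` carries a stationary
Killing field timelike on the far cylinder. Why it might fail: the Killing field born near `i⁰` must be
extended through the photon region without analyticity (Ionescu–Klainerman: no continuation argument from
the horizon alone; here none from infinity alone either). [cite: AlexakisSchlue2018, Thm. 1.1] -/
def SilentIsStationary : Prop :=
  ∀ (M R : ℝ) (C : ℕ → ℝ) (𝓢 : Spacetime.{0} 4) [𝓢.metric.toPseudoRiemannianMetric.HasLeviCivita] [Kerr.Facts]
    (Φ : Kerr.region (0 : ℝ) R → 𝓢.carrier), SEKHyp M R C 𝓢 Φ → FarGuard 𝓢 Φ → StationaryNearEnd 𝓢 Φ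

/-- **U_glob — globally stationary eternal vacua are Kerr or flat** (the non-transferable half: smooth
stationary black-hole uniqueness without analyticity or near-Kerr smallness, plus "no stationary geon";
the complete case with an everywhere-timelike field is Anderson 2000, `Anderson2000_stationaryVacuum_flat`).
Why it might fail: open since Carter–Robinson outside the analytic / near-Kerr regimes.
[cite: AlexakisIonescuKlainerman2009, Thm 1.1] -/
def StationaryIsKerrOrFlat : Prop :=
  ∀ (M R : ℝ) (C : ℕ → ℝ) (𝓢 : Spacetime.{0} 4) [𝓢.metric.toPseudoRiemannianMetric.HasLeviCivita] [Kerr.Facts]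
    (Φ : Kerr.region (0 : ℝ) R → 𝓢.carrier),
    SEKHyp M R C 𝓢 Φ → FarGuard 𝓢 Φ → StationaryNearEnd 𝓢 Φ → SEKConcl 𝓢 Φ

/-- **SEK_guarded**: SEK with the far guard added to its hypotheses (what the composition of the registered
line actually needs: every hull element supplies the guard through `IsTameEnd.far_future`). [folklore] -/
def SilentEternalIsKerrGuarded : Prop :=
  ∀ (M R : ℝ) (C : ℕ → ℝ) (𝓢 : Spacetime.{0} 4) [𝓢.metric.toPseudoRiemannianMetric.HasLeviCivita] [Kerr.Facts]
    (Φ : Kerr.region (0 : ℝ) R → 𝓢.carrier), SEKHyp M R C 𝓢 Φ → FarGuard 𝓢 Φ → SEKConcl 𝓢 Φ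

/-- **Assembly of the re-cut** (modus ponens): B′_glob and U_glob give the guarded dock. [folklore] -/
theorem sekGuarded_of_recut (hB : SilentIsStationary) (hU : StationaryIsKerrOrFlat) :
    SilentEternalIsKerrGuarded :=
  fun M R C 𝓢 _ _ Φ hyp hg ↦ hU M R C 𝓢 Φ hyp hg (hB M R C 𝓢 Φ hyp hg)

/-- The guarded dock is WEAKER than the registered one. [folklore] -/
theorem sekGuarded_of_sek (h : SilentEternalIsKerr) : SilentEternalIsKerrGuarded :=
  fun M R C 𝓢 _ _ Φ hyp _ ↦ sek_iff.1 h M R C 𝓢 Φ hyp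

/-- Neither piece of the re-cut is the dock on its own for a trivial reason: U_glob follows from the
guarded dock (it has MORE hypotheses), so the content U_glob adds beyond SEK_guarded is nil — the split
is `SEK_guarded ⇐ B′ ∧ U` with U ≤ SEK_guarded and B′ independent. [folklore] -/
theorem stationaryIsKerrOrFlat_of_sekGuarded (h : SilentEternalIsKerrGuarded) : StationaryIsKerrOrFlat :=
  fun M R C 𝓢 _ _ Φ hyp hg _ ↦ h M R C 𝓢 Φ hyp hg

/-! ### §3 The re-indexing schema (Weaker intermediate) -/

section Reindex

/-- A pointwise extra hypothesis on vacuum developments (the `H` of the census). [folklore] -/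
abbrev DevPred : Type 1 :=
  ∀ ⦃X : Type⦄ [TopologicalSpace X] [ChartedSpace E3 X] [IsManifold (𝓡 3) ∞ X] [T2Space X]
    [SecondCountableTopology X] [ConnectedSpace X] ⦃D : InitialDataSet (𝓡 3) X⦄, VacuumCauchyDevelopment D → Prop

variable {X : Type} [TopologicalSpace X] [ChartedSpace E3 X] [IsManifold (𝓡 3) ∞ X]
  [T2Space X] [SecondCountableTopology X] [ConnectedSpace X] {D : InitialDataSet (𝓡 3) X}

/-- The conclusion of K2R for one development, verbatim. [cite: DafermosLuk2017, Conjecture 1] -/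
def Resolves (𝒟 : VacuumCauchyDevelopment D) : Prop :=
  ∃ (O : Set 𝒟.carrier) (d : FinalStateDecomposition 𝒟.toSpacetime O 2),
    O = _root_.Summit.FinalStateConjecture.exteriorOf 𝒟.toCauchyDevelopment d.charted ∧
    _root_.Summit.FinalStateConjecture.RaysStayInClosure 𝒟.toCauchyDevelopment O ∧
    _root_.Summit.FinalStateConjecture.HasExhaustiveCharts d ∧
    _root_.Summit.FinalStateConjecture.IsFutureOriented d

end Reindex

/-- **K2R_H — conditional resolution under the extra pointwise hypothesis `H`** (the K1R antecedent, inert in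
the registered composition, is dropped). [cite: DafermosLuk2017, Conjecture 1] -/
def ChannelsResolveWith (H : DevPred) : Prop :=
  ∀ (X : Type) [TopologicalSpace X] [ChartedSpace E3 X] [IsManifold (𝓡 3) ∞ X] [T2Space X]
    [SecondCountableTopology X] [ConnectedSpace X], ∀ D ∈ admissibleVacuumData X,
    ∀ 𝒟 : VacuumCauchyDevelopment D, DevHyp 𝒟 → H 𝒟 → Resolves 𝒟

/-- **K3_H — tame censorship carrying `H`**: the bundled tame-generic property of `TameCensorship` with the
extra conjunct `H 𝒟`. [cite: Christodoulou1999, Thm 1] -/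
def TameCensorshipWith (H : DevPred) : Prop :=
  ∀ (X : Type) [TopologicalSpace X] [ChartedSpace E3 X] [IsManifold (𝓡 3) ∞ X] [T2Space X]
    [SecondCountableTopology X] [ConnectedSpace X],
    InitialDataSet.IsTameChristodoulouGeneric (admissibleVacuumData X)
      (fun D => (∃ 𝒟 : VacuumCauchyDevelopment D, 𝒟.IsMaximal) ∧
        ∀ 𝒟 : VacuumCauchyDevelopment D, 𝒟.IsMaximal →
          _root_.Summit.FinalStateConjecture.HasCompleteNullInfinity 𝒟.toCauchyDevelopment ∧
          NoExtremalRemnant 𝒟 ∧ TameOuter 𝒟 ∧ H 𝒟) 1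

/-- **The re-indexing schema**: for EVERY pointwise hypothesis `H`, `K2R_H ∧ K3_H ⇒ FinalStateConjecture`
(the `closes` proof of the route with one more conjunct transported by `mono`). Every weakening of the crux
by an `H` is paid, one for one, in the censorship crux. [cite: Christodoulou1999, Thm 1] -/
theorem finalState_of_reindexed (H : DevPred) (h₂ : ChannelsResolveWith H) (h₃ : TameCensorshipWith H) :
    _root_.FinalStateConjecture := by
  intro X i₁ i₂ i₃ i₄ i₅ i₆
  have mono : ∀ {P Q : _ → Prop},
      (∀ D ∈ admissibleVacuumData X, Q D → P D) →
      InitialDataSet.IsTameChristodoulouGeneric (admissibleVacuumData X) Q 1 →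
      InitialDataSet.IsTameChristodoulouGeneric (admissibleVacuumData X) P 1 := by
    intro P Q hQP hQ D hD
    obtain ⟨e, F, hF, himm, h0, hinj, hadm, hexc⟩ := hQ D ⟨hD.1, fun h => hD.2 (hQP D hD.1 h)⟩
    exact ⟨e, F, hF, himm, h0, hinj, hadm,
      fun c hc hmem => hexc c hc ⟨hmem.1, fun h => hmem.2 (hQP _ hmem.1 h)⟩⟩
  refine mono ?_ (h₃ X)
  rintro D hD ⟨hex, hQ⟩
  refine ⟨hex, fun 𝒟 hmax => ?_⟩
  obtain ⟨hcomp, hi, hii, hH⟩ := hQ 𝒟 hmax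
  obtain ⟨O, d, hO, hrays, hexh, hfo⟩ := h₂ X D hD 𝒟 ⟨hmax, hcomp, hi, hii⟩ hH
  refine ⟨hcomp, O, d, fun i => ?_, hO, hrays, hexh, hfo⟩
  rcases lt_or_eq_of_le (d.abs_spin_le_mass i) with hlt | heq
  · exact hlt
  · exact absurd ⟨d.τ₀, d.chart i, ⟨(d.isLateChart i).contMDiff, (d.isLateChart i).isOpenEmbedding,
        Set.subset_univ _⟩, d.tendsto_truncDeviationCk i⟩
      (hi (d.motion i).1 (d.motion i).2 (d.mass i) (d.spin i) ⟨heq, d.mass_pos i⟩)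

/-- `K2R_H` is ANTITONE in `H`: a stronger pointwise hypothesis gives a weaker crux. [folklore] -/
theorem channelsResolveWith_mono {H H' : DevPred}
    (hle : ∀ ⦃X : Type⦄ [TopologicalSpace X] [ChartedSpace E3 X] [IsManifold (𝓡 3) ∞ X] [T2Space X]
      [SecondCountableTopology X] [ConnectedSpace X] ⦃D : InitialDataSet (𝓡 3) X⦄
      (𝒟 : VacuumCauchyDevelopment D), H' 𝒟 → H 𝒟)
    (h : ChannelsResolveWith H) : ChannelsResolveWith H' :=
  fun X _ _ _ _ _ _ D hD 𝒟 hdev hH' ↦ h X D hD 𝒟 hdev (hle 𝒟 hH')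

/-- … and `K3_H` is MONOTONE the other way: the price of the weakening is paid in censorship. [folklore] -/
theorem tameCensorshipWith_anti {H H' : DevPred}
    (hle : ∀ ⦃X : Type⦄ [TopologicalSpace X] [ChartedSpace E3 X] [IsManifold (𝓡 3) ∞ X] [T2Space X]
      [SecondCountableTopology X] [ConnectedSpace X] ⦃D : InitialDataSet (𝓡 3) X⦄
      (𝒟 : VacuumCauchyDevelopment D), H' 𝒟 → H 𝒟)
    (h : TameCensorshipWith H') : TameCensorshipWith H := by
  intro X i₁ i₂ i₃ i₄ i₅ i₆ D hD
  have hD' : D ∈ admissibleVacuumData X ∧ ¬ ((∃ 𝒟 : VacuumCauchyDevelopment D, 𝒟.IsMaximal) ∧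
      ∀ 𝒟 : VacuumCauchyDevelopment D, 𝒟.IsMaximal →
        _root_.Summit.FinalStateConjecture.HasCompleteNullInfinity 𝒟.toCauchyDevelopment ∧
        NoExtremalRemnant 𝒟 ∧ TameOuter 𝒟 ∧ H' 𝒟) :=
    ⟨hD.1, fun h' => hD.2 ⟨h'.1, fun 𝒟 hm => let ⟨a, b, c, e⟩ := h'.2 𝒟 hm; ⟨a, b, c, hle 𝒟 e⟩⟩⟩
  obtain ⟨e, F, hF, himm, h0, hinj, hadm, hexc⟩ := h X D hD'
  exact ⟨e, F, hF, himm, h0, hinj, hadm, fun c hc hmem => hexc c hc ⟨hmem.1, fun h' => hmem.2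
    ⟨h'.1, fun 𝒟 hm => let ⟨a, b, c', e'⟩ := h'.2 𝒟 hm; ⟨a, b, c', hle 𝒟 e'⟩⟩⟩⟩

/-- The registered crux is `K2R_H` at the trivial hypothesis (K1R is a theorem, `UniformPhotonSphereChannelsR_holds`,
so its antecedent is discharged). [folklore] -/
theorem channelsResolveWith_true_of_K2R (h : ChannelsResolveTameDevelopmentsR) :
    ChannelsResolveWith (fun _ _ _ _ _ _ _ _ _ ↦ True) := by
  intro X _ _ _ _ _ _ D hD 𝒟 hdev _
  exact h UniformPhotonSphereChannelsR_holds X D hD 𝒟 hdev.maximal hdev.scri ⟨hdev.noRemnant, hdev.tame⟩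

/-- **H7 — no exotic stationary remnant** (the census's candidate pointwise hypothesis with teeth): every hull
element of `𝒟`, in any class, whose spacetime is STATIONARY with respect to its far cylinder is Minkowski or has
a sub-extremal Kerr d.o.c. Pointwise checkable on examples, implied by smooth no-hair, NOT implied by the summit
statement for the given datum; moving it into K3 relocates smooth black-hole uniqueness from the resolution crux
(where it is needed for EVERY tame development) to the censorship crux (where it is needed GENERICALLY).
[cite: AlexakisIonescuKlainerman2009, Thm 1.1] -/
def NoExoticStationaryRemnant : DevPred := fun _ _ _ _ _ _ _ _ 𝒟 ↦
  ∀ [𝒟.metric.HasLeviCivita],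
    ∀ (Λ : ℝ≥0) (r₀ : ℝ) (q : ℕ → 𝒟.carrier) (𝓢 : Spacetime.{0} 4) (E : EndDatum 𝓢) (p : 𝓢.carrier),
      IsHullElement 𝒟 Λ r₀ q 𝓢 E p → ∀ [𝓢.metric.toPseudoRiemannianMetric.HasLeviCivita],
        StationaryNearEnd 𝓢 E.far → IsMinkowski 𝓢 ∨ ∃ M a : ℝ, 0 < M ∧ |a| < M ∧ IsKerrDoc 𝓢 E.doc M a

/-- The re-indexed pair at H7 decides the summit (instance of the schema). [cite: Christodoulou1999, Thm 1] -/
theorem finalState_of_reindexed_H7 (h₂ : ChannelsResolveWith NoExoticStationaryRemnant)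
    (h₃ : TameCensorshipWith NoExoticStationaryRemnant) : _root_.FinalStateConjecture :=
  finalState_of_reindexed _ h₂ h₃

end Summit.FinalStateConjecture.FinalStateConjecture.Cruxes.ChannelsResolveTameDevelopmentsR.CensusS9

end
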